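import Mathlib.NumberTheory.NumberField.CMField
import Mathlib.FieldTheory.KummerExtension
import Mathlib.Data.Nat.Squarefree
import HarnessLib

/-!
# Imaginary quadratic fields: a generator `a` with `a² = −d`, `d` squarefree, and isomorphism from equal `d`

Topic `NumberTheory/ComplexMultiplication`; namespace `Literature.NumberTheory.ComplexMultiplication`, grouping
sub-namespace `ImaginaryQuadratic`.  Theorems only (Mathlib only; no definition, no named fact, no instance).

Let `K` be a number field of degree `2` which is totally complex (an IMAGINARY QUADRATIC field; every CM field of
degree `2` is one, Mathlib `NumberField.IsCMField.isTotallyComplex`).  Classical normal form: `K = ℚ(√-d)` for a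
unique squarefree positive integer `d` (Shimura, *Abelian varieties with complex multiplication* (1998), §18.2 (1):
a CM field is `F(√-Δ)`; here `F = ℚ` and `Δ` is normalised to a squarefree integer).

* `exists_sq_eq_algebraMap_adjoin_eq_top` — every quadratic number field is `ℚ(a)` with `a² ∈ ℚ` (Kummer theory for
  the cyclic extension `K/ℚ` of degree `2`, `-1 ∈ ℚ` a primitive square root of unity: Mathlib
  `exists_root_adjoin_eq_top_of_isCyclic`);
* `lt_zero_of_sq_eq_algebraMap` — if moreover `K` is totally complex then `a² = q < 0` (otherwise `φ(a) ∈ ℝ` for a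
  complex embedding `φ`, and `φ` would be real on `ℚ(a) = K`);
* **`exists_sq_eq_neg_squarefree`** — hence some `a ∈ K` has `a² = -d` with `d ∈ ℕ` SQUAREFREE (clear the denominator
  of `q` and divide out the square part of the resulting integer, Mathlib `Nat.sq_mul_squarefree_of_pos`);
* `minpoly_eq_of_sq_eq_neg`, `adjoin_eq_top_of_sq_eq_neg` — for `a² = -d`, `d ≠ 0`: `minpoly_ℚ a = X² + d` and
  `ℚ(a) = K`;
* **`nonempty_algEquiv_of_sq_eq_neg`** — two quadratic number fields containing square roots of the SAME `-d` are
  isomorphic (`PowerBasis.equivOfMinpoly`);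
* (private: squarefree naturals `m, n` with `m n` a square are equal); so
  **`not_isSquare_mul_of_isEmpty_ringEquiv`**: if `K ≄ K'` are quadratic number fields with `a² = -d` in `K`,
  `a'² = -d'` in `K'`, `d, d'` squarefree, then `d d'` is not a square — the form in which "the imaginary quadratic
  fields `K_i` are pairwise non-isomorphic" enters Kubota separation / Moonen–Zarhin Cor. (3.9) for products of CM
  elliptic curves (`Summits/HodgeConjecture/CorCM/QuadraticCMFamiliesSeparating.lean` takes exactly the generators
  `a_i² = -d_i`, `d_i d_j` non-square, as data).

What is NOT here: the converse "`K ≃ K'` forces `d = d'`" (not needed downstream), rings of integers, discriminants.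

## References

* G. Shimura, *Abelian Varieties with Complex Multiplication and Modular Functions*, Princeton 1998, §18.2 (1).
  [folklore]
-/

noncomputable section

open NumberField Polynomial IntermediateField Module
open scoped ComplexConjugate

namespace Literature.NumberTheory.ComplexMultiplication

namespace ImaginaryQuadratic

/-! ### Squarefree naturals with a square product are equal -/

/-- **Squarefree `m, n ∈ ℕ` with `m · n` a perfect square are equal**: a prime dividing `m` divides `m n` to the
first power unless it divides `n`, and exponents in a square are even (private helper). [folklore] -/
private theorem squarefree_eq_of_isSquare_mul {m n : ℕ} (hm : Squarefree m) (hn : Squarefree n) (h : IsSquare (m * n)) :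
    m = n := by
  obtain ⟨r, hr⟩ := h
  have hr0 : r ≠ 0 := by
    rintro rfl
    exact mul_ne_zero hm.ne_zero hn.ne_zero (by rw [hr, mul_zero])
  have key : ∀ {m n : ℕ}, Squarefree m → Squarefree n → m * n = r * r → ∀ p : ℕ, p.Prime → p ∣ m → p ∣ n := by
    intro m n hm hn hr p hp hpm
    by_contra hpn
    have h1 : m.factorization p = 1 :=
      le_antisymm (hm.natFactorization_le_one p) ((hp.dvd_iff_one_le_factorization hm.ne_zero).1 hpm)
    have h2 : n.factorization p = 0 := Nat.factorization_eq_zero_of_not_dvd hpn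
    have h3 := congrArg (fun k : ℕ => k.factorization p) hr
    simp only [Nat.factorization_mul hm.ne_zero hn.ne_zero, Nat.factorization_mul hr0 hr0, Finsupp.add_apply,
      h1, h2] at h3
    omega
  exact (Nat.Squarefree.ext_iff hm hn).2 fun p hp => ⟨key hm hn hr p hp, key hn hm (by rw [mul_comm]; exact hr) p hp⟩

/-! ### A complex number with non-negative real square is real -/

/-- `z² = x` with `x ≥ 0` real forces `z ∈ ℝ` (`Im z = 0`) (private helper). [folklore] -/
private theorem im_eq_zero_of_sq_eq_ofReal {z : ℂ} {x : ℝ} (hx : 0 ≤ x) (hz : z ^ 2 = (x : ℂ)) : z.im = 0 := by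
  have hre := congrArg Complex.re hz
  have him := congrArg Complex.im hz
  simp only [sq, Complex.mul_re, Complex.mul_im, Complex.ofReal_re, Complex.ofReal_im] at hre him
  by_contra h
  have hre0 : z.re = 0 := by
    rcases mul_eq_zero.1 (show z.re * z.im = 0 by linarith) with h1 | h1
    · exact h1
    · exact absurd h1 h
  rw [hre0] at hre
  have : 0 < z.im * z.im := mul_self_pos.2 h
  linarith

/-! ### Every quadratic number field is `ℚ(a)` with `a² ∈ ℚ` -/

variable {K : Type*} [Field K] [NumberField K]

/-- **A quadratic number field is `ℚ(a)` with `a² ∈ ℚ`**: `K/ℚ` is cyclic of degree `2` and `ℚ` contains the primitive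
square root of unity `-1`, so Kummer theory applies (Mathlib `exists_root_adjoin_eq_top_of_isCyclic`) — the first
half of the normal form `K = F(√-α)` of a CM field, here `F = ℚ`. [cite: Shimura1998, §18.2 (1)] -/
theorem exists_sq_eq_algebraMap_adjoin_eq_top (hK : finrank ℚ K = 2) :
    ∃ (a : K) (q : ℚ), a ^ 2 = algebraMap ℚ K q ∧ ℚ⟮a⟯ = ⊤ := by
  haveI : Algebra.IsQuadraticExtension ℚ K := { finrank_eq_two' := hK }
  have hroots : (primitiveRoots (finrank ℚ K) ℚ).Nonempty := by
    refine ⟨-1, ?_⟩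
    rw [hK, mem_primitiveRoots two_pos]
    exact IsPrimitiveRoot.neg_one 0 (by decide)
  obtain ⟨a, ⟨q, hq⟩, htop⟩ := exists_root_adjoin_eq_top_of_isCyclic ℚ K hroots
  exact ⟨a, q, by rw [← hK]; exact hq.symm, htop⟩

/-- **In a totally complex quadratic field the square of a Kummer generator is negative**: if `a² = q ∈ ℚ` and
`ℚ(a) = K` then `q < 0` — otherwise `φ(a)² = q ≥ 0` makes `φ(a)` real for any complex embedding `φ`, and then `φ`
is real on `ℚ(a) = K`, contradicting total complexity; i.e. `α = -q` is (totally) positive in the normal form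
`K = ℚ(√-α)`. [cite: Shimura1998, §18.2 (1)] -/
theorem lt_zero_of_sq_eq_algebraMap [IsTotallyComplex K] {a : K} {q : ℚ} (ha : a ^ 2 = algebraMap ℚ K q)
    (htop : ℚ⟮a⟯ = ⊤) : q < 0 := by
  by_contra! hq
  obtain ⟨φ⟩ := (inferInstance : Nonempty (K →+* ℂ))
  have hz : (φ a) ^ 2 = ((q : ℝ) : ℂ) := by
    rw [← map_pow, ha, eq_ratCast, map_ratCast, Complex.ofReal_ratCast]
  have him : (φ a).im = 0 := im_eq_zero_of_sq_eq_ofReal (by exact_mod_cast hq) hz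
  have hconj : conj (φ a) = φ a := Complex.conj_eq_iff_im.2 him
  have hint : IsIntegral ℚ a := .of_finite ℚ a
  have hadj : Algebra.adjoin ℚ {a} = ⊤ := by
    rw [← adjoin_simple_toSubalgebra_of_isAlgebraic hint.isAlgebraic, htop, top_toSubalgebra]
  have heq : (ComplexEmbedding.conjugate φ).toRatAlgHom = φ.toRatAlgHom :=
    AlgHom.ext_of_adjoin_eq_top hadj fun x hx => by
      rw [Set.mem_singleton_iff] at hx
      subst hx
      rw [RingHom.toRatAlgHom_apply, RingHom.toRatAlgHom_apply, ComplexEmbedding.conjugate_coe_eq, hconj]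
  have hreal : ComplexEmbedding.IsReal φ := by
    rw [ComplexEmbedding.isReal_iff]
    exact RingHom.ext fun x => by
      rw [← RingHom.toRatAlgHom_apply (ComplexEmbedding.conjugate φ), heq, RingHom.toRatAlgHom_apply]
  exact IsTotallyComplex.complexEmbedding_not_isReal φ hreal

/-- **An imaginary quadratic field contains `a` with `a² = -d`, `d ∈ ℕ` squarefree** (`K = ℚ(√-d)`): take a Kummer
generator `a₀² = q < 0`, clear the denominator (`(den q · a₀)² = den q · num q = -N`, `N ≥ 1`) and divide out the
square part of `N = f² d` (Mathlib `Nat.sq_mul_squarefree_of_pos`). [cite: Shimura1998, §18.2 (1)] -/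
theorem exists_sq_eq_neg_squarefree [IsTotallyComplex K] (hK : finrank ℚ K = 2) :
    ∃ (a : K) (d : ℕ), Squarefree d ∧ a ^ 2 = -(d : K) := by
  obtain ⟨a, q, ha, htop⟩ := exists_sq_eq_algebraMap_adjoin_eq_top hK
  have hq : q < 0 := lt_zero_of_sq_eq_algebraMap ha htop
  have hnum : q.num < 0 := Rat.num_neg.2 hq
  set N : ℕ := q.den * q.num.natAbs with hN
  have hN0 : 0 < N := Nat.mul_pos q.den_pos (Int.natAbs_pos.2 hnum.ne)
  have hqN : (q.den : ℚ) ^ 2 * q = -(N : ℚ) := by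
    have h1 : q * q.den = q.num := Rat.mul_den_eq_num q
    have h2 : ((q.num.natAbs : ℕ) : ℚ) = -(q.num : ℚ) := by
      rw [← Int.cast_natCast, Int.natCast_natAbs, abs_of_neg hnum, Int.cast_neg]
    rw [hN, Nat.cast_mul, h2, sq, mul_assoc, mul_comm (q.den : ℚ) q, h1]
    ring
  have hb : ((q.den : K) * a) ^ 2 = -(N : K) := by
    rw [mul_pow, ha, ← map_natCast (algebraMap ℚ K) q.den, ← map_pow, ← map_mul, hqN, map_neg, map_natCast]
  obtain ⟨d, f, -, hf, hfd, hd⟩ := Nat.sq_mul_squarefree_of_pos hN0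
  refine ⟨(q.den : K) * a / f, d, hd, ?_⟩
  have hf0 : (f : K) ≠ 0 := Nat.cast_ne_zero.2 hf.ne'
  rw [div_pow, hb, ← hfd, Nat.cast_mul, Nat.cast_pow, neg_div, mul_div_cancel_left₀ _ (pow_ne_zero 2 hf0)]

/-! ### `a² = -d`, `d ≠ 0`: minimal polynomial, primitivity, isomorphism -/

/-- `X² + d` (`d ∈ ℕ`, `d ≠ 0`) is irreducible over `ℚ`: `-d` is not a rational square (private helper). [folklore] -/
private theorem irreducible_X_sq_sub_C_neg {d : ℕ} (hd : d ≠ 0) : Irreducible (X ^ 2 - C (-(d : ℚ))) := by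
  refine (X_pow_sub_C_irreducible_iff_of_prime Nat.prime_two).2 fun b hb => ?_
  have h0 : (0 : ℚ) ≤ b ^ 2 := sq_nonneg b
  have h1 : (0 : ℚ) < d := Nat.cast_pos.2 (Nat.pos_of_ne_zero hd)
  rw [hb] at h0
  linarith

/-- For `a² = -d` (`d ≠ 0`) in a field of characteristic `0`, `minpoly_ℚ a = X² + d` (the quadratic polynomial of
the normal form `ℚ(√-d)`). [cite: Shimura1998, §18.2 (1)] -/
theorem minpoly_eq_of_sq_eq_neg {L : Type*} [Field L] [Algebra ℚ L] {a : L} {d : ℕ} (hd : d ≠ 0)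
    (ha : a ^ 2 = -(d : L)) : minpoly ℚ a = X ^ 2 - C (-(d : ℚ)) := by
  have hmonic : (X ^ 2 - C (-(d : ℚ))).Monic := monic_X_pow_sub_C _ two_ne_zero
  have haeval : aeval a (X ^ 2 - C (-(d : ℚ))) = 0 := by
    simp only [map_sub, map_pow, aeval_X, map_neg, map_natCast, ha, sub_self]
  exact (minpoly.eq_of_irreducible_of_monic (irreducible_X_sq_sub_C_neg hd) haeval hmonic).symm

/-- The generator `gen` of `ℚ⟮a⟯` satisfies the same equation `gen² = -d` (private helper). [folklore] -/
private theorem adjoinSimpleGen_sq_eq_neg {a : K} {d : ℕ} (ha : a ^ 2 = -(d : K)) :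
    (AdjoinSimple.gen ℚ a) ^ 2 = -(d : ℚ⟮a⟯) :=
  (algebraMap ℚ⟮a⟯ K).injective (by rw [map_pow, AdjoinSimple.algebraMap_gen, map_neg, map_natCast, ha])

/-- For `a² = -d` (`d ≠ 0`) in a QUADRATIC number field, `ℚ(a) = K` (`deg minpoly_ℚ a = 2 = [K : ℚ]`): `K = ℚ(√-d)`.
[cite: Shimura1998, §18.2 (1)] -/
theorem adjoin_eq_top_of_sq_eq_neg (hK : finrank ℚ K = 2) {a : K} {d : ℕ} (hd : d ≠ 0) (ha : a ^ 2 = -(d : K)) :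
    ℚ⟮a⟯ = ⊤ := by
  rw [Field.primitive_element_iff_minpoly_natDegree_eq, minpoly_eq_of_sq_eq_neg hd ha, natDegree_X_pow_sub_C, hK]

/-- **Quadratic number fields with square roots of the same `-d` are isomorphic**: both are `ℚ(a) ≅ ℚ[X]/(X² + d)`
(`PowerBasis.equivOfMinpoly` on the power bases of `ℚ(a)`, `ℚ(a')`). [cite: Shimura1998, §18.2 (1)] -/
theorem nonempty_algEquiv_of_sq_eq_neg {K' : Type*} [Field K'] [NumberField K'] (hK : finrank ℚ K = 2)
    (hK' : finrank ℚ K' = 2) {d : ℕ} (hd : d ≠ 0) {a : K} {a' : K'} (ha : a ^ 2 = -(d : K))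
    (ha' : a' ^ 2 = -(d : K')) : Nonempty (K ≃ₐ[ℚ] K') := by
  have hint : IsIntegral ℚ a := .of_finite ℚ a
  have hint' : IsIntegral ℚ a' := .of_finite ℚ a'
  have hmin : minpoly ℚ (adjoin.powerBasis hint).gen = minpoly ℚ (adjoin.powerBasis hint').gen := by
    rw [adjoin.powerBasis_gen, adjoin.powerBasis_gen, minpoly_eq_of_sq_eq_neg hd (adjoinSimpleGen_sq_eq_neg ha),
      minpoly_eq_of_sq_eq_neg hd (adjoinSimpleGen_sq_eq_neg ha')]
  exact ⟨((equivOfEq (adjoin_eq_top_of_sq_eq_neg hK hd ha)).trans topEquiv).symm.trans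
    (((adjoin.powerBasis hint).equivOfMinpoly (adjoin.powerBasis hint') hmin).trans
      ((equivOfEq (adjoin_eq_top_of_sq_eq_neg hK' hd ha')).trans topEquiv))⟩

/-- **Non-isomorphic imaginary quadratic fields have generators with non-square product**: if `K ≄ K'` are
quadratic number fields, `a² = -d` in `K` and `a'² = -d'` in `K'` with `d, d'` squarefree, then `d d'` is not a
square (were it one, `d = d'` and `K ≅ ℚ[X]/(X² + d) ≅ K'`).  This is how "`ℚ(√-d_i)` pairwise non-isomorphic",
i.e. "the CM elliptic curves `E_i` pairwise non-isogenous", feeds Kubota separation for `∏_i E_i`.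
[cite: Shimura1998, §18.2 (1)] -/
theorem not_isSquare_mul_of_isEmpty_ringEquiv {K' : Type*} [Field K'] [NumberField K'] (hK : finrank ℚ K = 2)
    (hK' : finrank ℚ K' = 2) {d d' : ℕ} (hd : Squarefree d) (hd' : Squarefree d') {a : K} {a' : K'}
    (ha : a ^ 2 = -(d : K)) (ha' : a' ^ 2 = -(d' : K')) (hKK' : IsEmpty (K ≃+* K')) : ¬IsSquare (d * d') := by
  intro hsq
  obtain rfl := squarefree_eq_of_isSquare_mul hd hd' hsq
  obtain ⟨e⟩ := nonempty_algEquiv_of_sq_eq_neg hK hK' hd.ne_zero ha ha'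
  exact hKK'.false e.toRingEquiv

end ImaginaryQuadratic

end Literature.NumberTheory.ComplexMultiplication

end
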